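import Literature.Geometry.Kaehler.ComplexTorusAnalyticIntersectionCycle
import Literature.Geometry.Kaehler.ComplexTorusAnalyticCycleDegreeComponents
import HarnessLib

/-!
# Bézout-type inequalities for proper intersections on a complex torus

Let `X = E/Λ` be a complex torus of dimension `g` and `Y₁, Y₂ ⊆ X` closed analytic subsets of pure dimensions
`d₁, d₂` meeting PROPERLY: `Y₁ ∩ Y₂` has the expected pure dimension `q + 1 = d₁ + d₂ − g ≥ 1`. By
`ComplexTorusAnalyticIntersectionCycle` §6 (Fulton, Prop. 7.1 (a)),
`sign(e) · [Y₁]_e ∧ [Y₂]_e = Σ_C i(C) · [C]` over the irreducible components `C` of `Y₁ ∩ Y₂`, with integers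
`i(C) ≥ 1`; and `[Y₁ ∩ Y₂] = Σ_C [C]` (`analyticCycleClass_eq_sum_setCycleClass`). Hence the intersection product
dominates the reduced intersection against every form pairing non-negatively with subvarieties
(`re_poincarePairing_analyticCycleClass_inter_le_smul_wedge`), which yields the two classical Bézout-type
inequalities:

* `measureReal_inter_le_re_poincarePairing_kaehlerPow_smul_wedge` — **`vol(Y₁ ∩ Y₂) ≤ deg(Y₁ · Y₂)`**: the
  `2(q+1)`-volume of the proper intersection (in a period box of the universal cover) is at most the degree
  `Re ⟨ω₀^{q+1}/(q+1)!, sign(e)[Y₁] ∧ [Y₂]⟩ = Σ_C i(C) vol(C)` of the intersection cycle (Wirtinger,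
  [Chirka1989, §13.3 Cor.]);
* `IsRiemannForm.ncard_isIrreducibleComponent_inter_le_re_poincarePairing_smul_wedge` — **the number of
  irreducible components of a proper intersection is at most its intersection degree
  `(Y₁ · Y₂ · L^{q+1})`** for any polarisation `L = c₁(η)`: Fulton, Example 8.4.6 ("the number of irreducible
  components of `V₁ ∩ … ∩ V_r` is at most `Π deg V_i`" — the mechanism `#components ≤ Σ_C i(C) deg_L C`, each
  `deg_L C ≥ 1` by [deJong1993AmpleLineBundles, Ch. VII §4 Remark 4.3 (a), Thm. 4.3.1]) and Example 12.2.1 (a)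
  (abelian varieties: intersection classes are represented by non-negative cycles);
  `…_le_of_poincarePairing_eq_natCast` — if that degree is the natural number `m`, there are at most `m`
  components.

Theorems only; no definitions, no instances, no named facts.

## References

* [Fulton1998] W. Fulton, *Intersection Theory*, 2nd ed., Springer 1998, §7.1 Prop. 7.1 (a), Example 8.4.6,
  §12.2 Cor. 12.2 (a) and Example 12.2.1 (a).
* [deJong1993AmpleLineBundles] J. de Jong (ed.), *Ample line bundles and intersection theory* (seminar notes),
  Ch. VII §4 Remarks 4.3 (a), (c), (e) and Thm. 4.3.1.
* [Chirka1989] E. M. Chirka, *Complex Analytic Sets*, Kluwer 1989, §13.3 Cor. (Wirtinger), §16.1.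
* [VoisinHodgeI2002] C. Voisin, *Hodge Theory and Complex Algebraic Geometry I*, CUP 2002, §11.1.2.
-/

noncomputable section

open scoped Manifold Topology ENNReal NNReal
open MeasureTheory MeasureTheory.Measure Set Function Filter Module TopologicalSpace Complex
open Literature.Geometry.GeometricMeasureTheory Literature.Analysis.Complex Literature.LinearAlgebra.Alternating

universe u

namespace Literature.Geometry.Kaehler

-- Nested operator-norm instances on `V [⋀^Fin m]→L[ℝ] F`, as in the tree's `Currents*.lean` files.
set_option maxSynthPendingDepth 2

namespace ComplexTorus

variable {ι : Type*} [Fintype ι] [DecidableEq ι] {E : Type u} [NormedAddCommGroup E] [InnerProductSpace ℂ E]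
  [FiniteDimensional ℂ E] [MeasurableSpace E] [BorelSpace E] (Φ : (ι → ℝ) ≃L[ℝ] E) {n : ℕ} (e : Fin n ≃ ι)
  {d₁ d₂ p₁ p₂ q : ℕ}

/-! ### §1 The intersection product dominates the reduced intersection -/

open Classical in
/-- **`Re ⟨θ, [Y₁ ∩ Y₂]⟩ ≤ Re ⟨θ, sign(e) [Y₁] ∧ [Y₂]⟩` for every form `θ` pairing non-negatively with the
components of the proper intersection.** Since `sign(e)[Y₁]_e ∧ [Y₂]_e = Σ_C i(C) [C]` with `i(C) ≥ 1`
(`exists_wedge_analyticCycleClass_eq_sum_isIrreducibleComponent_pos`, Fulton Prop. 7.1 (a)) and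
`[Y₁ ∩ Y₂] = Σ_C [C]` (`analyticCycleClass_eq_sum_setCycleClass`), the difference is
`Σ_C (i(C) − 1) Re ⟨θ, [C]⟩ ≥ 0`. [cite: Fulton1998, §7.1 Prop. 7.1 (a) and §12.2 Cor. 12.2 (a)]
[cite: VoisinHodgeI2002, §11.1.2 Def. 11.17 and Rem. 11.19] -/
theorem re_poincarePairing_analyticCycleClass_inter_le_smul_wedge (hk₁ : 2 * d₁ + 2 * p₁ = n)
    (hk₂ : 2 * d₂ + 2 * p₂ = n) (hq : 2 * (q + 1) + 2 * (p₁ + p₂) = n) {Y₁ Y₂ : Set (ComplexTorus Φ)}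
    (hY₁ : HasPureDim 𝓘(ℂ, E) Y₁ d₁) (hY₂ : HasPureDim 𝓘(ℂ, E) Y₂ d₂)
    (hI : HasPureDim 𝓘(ℂ, E) (Y₁ ∩ Y₂) (q + 1)) (θ : E [⋀^Fin (2 * (q + 1))]→L[ℝ] ℂ)
    (hθ : ∀ C, IsIrreducibleComponent 𝓘(ℂ, E) (Y₁ ∩ Y₂) C →
      0 ≤ (poincarePairing Φ e hq θ (setCycleClass Φ e hq C)).re) :
    (poincarePairing Φ e hq θ (analyticCycleClass Φ e hq hI)).re ≤
      (poincarePairing Φ e hq θ ((orientationSign Φ e : ℂ) •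
        ((analyticCycleClass Φ e hk₁ hY₁).wedge (analyticCycleClass Φ e hk₂ hY₂)).domDomCongr
          (finCongr (by ring : 2 * p₁ + 2 * p₂ = 2 * (p₁ + p₂))))).re := by
  have hs : ((orientationSign Φ e : ℤ) : ℂ) * orientationSign Φ e = 1 := by
    exact_mod_cast orientationSign_mul_self Φ e
  obtain ⟨i, hpos, -, hcl⟩ :=
    exists_wedge_analyticCycleClass_eq_sum_isIrreducibleComponent_pos Φ e hk₁ hk₂ hq hY₁ hY₂ hI
  rw [hcl, smul_smul, hs, one_smul, analyticCycleClass_eq_sum_setCycleClass Φ e hq hI, _root_.map_sum,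
    _root_.map_sum, Complex.re_sum, Complex.re_sum]
  refine Finset.sum_le_sum fun C hC ↦ ?_
  have hC' : IsIrreducibleComponent 𝓘(ℂ, E) (Y₁ ∩ Y₂) C :=
    (finite_isIrreducibleComponent Φ hI.isAnalyticSet).mem_toFinset.1 hC
  have h1 : (1 : ℝ) ≤ i C := by exact_mod_cast hpos C hC'
  rw [map_zsmul, zsmul_eq_mul, ← Complex.ofReal_intCast, Complex.re_ofReal_mul]
  exact le_mul_of_one_le_left (hθ C hC') h1

/-! ### §2 `vol(Y₁ ∩ Y₂) ≤ deg(Y₁ · Y₂)` -/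

open Classical in
/-- **`vol(Y₁ ∩ Y₂) ≤ deg(Y₁ · Y₂)`**: for a proper intersection, the `2(q+1)`-volume of `Y₁ ∩ Y₂` in a period
box is at most the degree `Re ⟨ω₀^{q+1}/(q+1)!, sign(e)[Y₁]_e ∧ [Y₂]_e⟩ = Σ_C i(C) vol(C)` of the intersection cycle
(Wirtinger: `⟨ω₀^{q+1}/(q+1)!, [C]⟩ = vol(C)`, and `i(C) ≥ 1`). [cite: Fulton1998, §7.1 Prop. 7.1 (a) and §12.2
Cor. 12.2 (a), Example 12.2.1 (a)] [cite: Chirka1989, §13.3 Cor. (Wirtinger)] -/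
theorem measureReal_inter_le_re_poincarePairing_kaehlerPow_smul_wedge (hk₁ : 2 * d₁ + 2 * p₁ = n)
    (hk₂ : 2 * d₂ + 2 * p₂ = n) (hq : 2 * (q + 1) + 2 * (p₁ + p₂) = n) {Y₁ Y₂ : Set (ComplexTorus Φ)}
    (hY₁ : HasPureDim 𝓘(ℂ, E) Y₁ d₁) (hY₂ : HasPureDim 𝓘(ℂ, E) Y₂ d₂)
    (hI : HasPureDim 𝓘(ℂ, E) (Y₁ ∩ Y₂) (q + 1)) :
    (μHE[2 * (q + 1)] : Measure E).real (periodBox Φ 0 ∩ (analyticChain Φ hI).carrier) ≤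
      (poincarePairing Φ e hq (ofRealCLM.compContinuousAlternatingMap (kaehlerPow (q + 1)))
        ((orientationSign Φ e : ℂ) •
          ((analyticCycleClass Φ e hk₁ hY₁).wedge (analyticCycleClass Φ e hk₂ hY₂)).domDomCongr
            (finCongr (by ring : 2 * p₁ + 2 * p₂ = 2 * (p₁ + p₂))))).re := by
  have h := re_poincarePairing_analyticCycleClass_inter_le_smul_wedge Φ e hk₁ hk₂ hq hY₁ hY₂ hI
    (ofRealCLM.compContinuousAlternatingMap (kaehlerPow (q + 1))) fun C hC ↦ by
      rw [re_poincarePairing_kaehlerPow_setCycleClass Φ e hq (IsIrreducibleComponent.hasPureDim hI hC)]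
      exact measureReal_nonneg
  rwa [poincarePairing_kaehlerPow_analyticCycleClass Φ e hq hI, Complex.ofReal_re] at h

/-! ### §3 Bézout: the number of components of a proper intersection is bounded by its degree -/

open Classical in
/-- **BÉZOUT'S BOUND ON THE NUMBER OF COMPONENTS: `#{irreducible components of Y₁ ∩ Y₂} ≤ (Y₁ · Y₂ · L^{q+1})`**
for a proper intersection on a polarised torus (`η` a Riemann form, `L` the polarisation,
`(Y₁ · Y₂ · L^{q+1}) = Re ⟨c₁(L)^{∧(q+1)}, sign(e)[Y₁]_e ∧ [Y₂]_e⟩`): every component `C` contributes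
`i(C) · deg_L C ≥ 1`. Fulton, Example 8.4.6: the number of irreducible components of an intersection is at most
the product of the degrees; Example 12.2.1 (a) for abelian varieties. [cite: Fulton1998, Example 8.4.6, §7.1 Prop.
7.1 (a) and §12.2 Example 12.2.1 (a)] [cite: deJong1993AmpleLineBundles, Ch. VII §4 Remarks 4.3 (a), (c) and Thm. 4.3.1] -/
theorem IsRiemannForm.ncard_isIrreducibleComponent_inter_le_re_poincarePairing_smul_wedge
    (hk₁ : 2 * d₁ + 2 * p₁ = n) (hk₂ : 2 * d₂ + 2 * p₂ = n) (hq : 2 * (q + 1) + 2 * (p₁ + p₂) = n)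
    {Y₁ Y₂ : Set (ComplexTorus Φ)} (hY₁ : HasPureDim 𝓘(ℂ, E) Y₁ d₁) (hY₂ : HasPureDim 𝓘(ℂ, E) Y₂ d₂)
    (hI : HasPureDim 𝓘(ℂ, E) (Y₁ ∩ Y₂) (q + 1)) {η : E [⋀^Fin 2]→L[ℝ] ℝ} (hη : IsRiemannForm Φ η) :
    (({C : Set (ComplexTorus Φ) | IsIrreducibleComponent 𝓘(ℂ, E) (Y₁ ∩ Y₂) C}.ncard : ℕ) : ℝ) ≤
      (poincarePairing Φ e hq (wedgePow (ofRealForm (-η)) (q + 1))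
        ((orientationSign Φ e : ℂ) •
          ((analyticCycleClass Φ e hk₁ hY₁).wedge (analyticCycleClass Φ e hk₂ hY₂)).domDomCongr
            (finCongr (by ring : 2 * p₁ + 2 * p₂ = 2 * (p₁ + p₂))))).re := by
  refine (hη.ncard_isIrreducibleComponent_le_re_poincarePairing_wedgePow_analyticCycleClass Φ e hq hI).trans ?_
  refine re_poincarePairing_analyticCycleClass_inter_le_smul_wedge Φ e hk₁ hk₂ hq hY₁ hY₂ hI _ fun C hC ↦ ?_
  rw [poincarePairing_setCycleClass Φ e hq (IsIrreducibleComponent.hasPureDim hI hC)]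
  exact zero_le_one.trans (hη.one_le_re_analyticCyclePeriod_wedgePow Φ (IsIrreducibleComponent.hasPureDim hI hC))

open Classical in
/-- **If `(Y₁ · Y₂ · L^{q+1}) = m ∈ ℕ` then the proper intersection `Y₁ ∩ Y₂` has at most `m` irreducible
components.** [cite: Fulton1998, Example 8.4.6 and §12.2 Example 12.2.1 (a)]
[cite: deJong1993AmpleLineBundles, Ch. VII §4 Remarks 4.3 (a), (c) and Thm. 4.3.1] -/
theorem IsRiemannForm.ncard_isIrreducibleComponent_inter_le_of_poincarePairing_eq_natCast
    (hk₁ : 2 * d₁ + 2 * p₁ = n) (hk₂ : 2 * d₂ + 2 * p₂ = n) (hq : 2 * (q + 1) + 2 * (p₁ + p₂) = n)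
    {Y₁ Y₂ : Set (ComplexTorus Φ)} (hY₁ : HasPureDim 𝓘(ℂ, E) Y₁ d₁) (hY₂ : HasPureDim 𝓘(ℂ, E) Y₂ d₂)
    (hI : HasPureDim 𝓘(ℂ, E) (Y₁ ∩ Y₂) (q + 1)) {η : E [⋀^Fin 2]→L[ℝ] ℝ} (hη : IsRiemannForm Φ η) {m : ℕ}
    (hm : poincarePairing Φ e hq (wedgePow (ofRealForm (-η)) (q + 1))
      ((orientationSign Φ e : ℂ) •
        ((analyticCycleClass Φ e hk₁ hY₁).wedge (analyticCycleClass Φ e hk₂ hY₂)).domDomCongr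
          (finCongr (by ring : 2 * p₁ + 2 * p₂ = 2 * (p₁ + p₂)))) = m) :
    {C : Set (ComplexTorus Φ) | IsIrreducibleComponent 𝓘(ℂ, E) (Y₁ ∩ Y₂) C}.ncard ≤ m := by
  have h := hη.ncard_isIrreducibleComponent_inter_le_re_poincarePairing_smul_wedge Φ e hk₁ hk₂ hq hY₁ hY₂ hI
  rw [hm, Complex.natCast_re] at h
  exact_mod_cast h

end ComplexTorus

end Literature.Geometry.Kaehler

end
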